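import Mathlib
import Summits.QuantumFields.YangMills.Theorems.BalabanUVNodesK2Line1PrimeRemainderPrice
import Summits.QuantumFields.YangMills.Theorems.EndpointGivenBR13SepCoPH.Negative.RemNamedJets13FalseOfTwoNormalisations
import Summits.QuantumFields.YangMills.Theorems.EndpointGivenBR13SepCoPH.Negative.Anchor13FalseOfTwoBaseHistories
import Summits.QuantumFields.YangMills.Theses.BalabanUVNodes

/-!
# CRIT-2 g2 — ROUND 2 probe (cell ym-nodeO-ideate; critic for idea-5..8) — kernel facts behind sheet `CRIT-2-ROUND2.md`

Cards graded: IDEA-5 g2 `convex-fibre-witten-modulus-kappa3` (edition 2; sketch `ConvexFibreWittenSketch2.lean` cb00301975b0efa7) and IDEA-7 g2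
`corner-limit-sign` (sketch `CornerLimitSignSketch.lean` 1126ef5ab277).  Sketches are not importable, so their record-level texts are COPIED VERBATIM (§A: idea-5's
`RemAtCPkg` ∕ `ModPkgAt` ∕ `ModulusAtSomeJets13` ∕ `RemAtCSomeJets13` ∕ `D1AtShadowingJetsC13` with the sketch's own proof of `remAtCPkg_of_modPkgAt`; §B: idea-7's
`CornerAnchor` ∕ `CornerSignRecord13`).

* §A ★ `modulusPair13_false_of_twoNormalisations` — idea-5's line {1″ `D1AtShadowingJetsC13`, 2ᴹ `ModulusAtSomeJets13`} is FALSE MODULO CRIT-1 g2's «two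
  normalisations» hypothesis (p592392 `remNamedJetsC_pair_false_of_twoNormalisations` ∘ the card's `remAtCSomeJets13_of_modulusAtSomeJets13`): the exposure is the
  INHERITED `∀ F ∃ κ ∀ θ` with θ-independent reference `beta0OfJs F κ` (same as v3 2′ ∕ an4 2″), not the card's engine; repair = CRIT-1's θ-covariant letter.
* §B ★ `cornerSign13_false_of_zeroOnBox` — idea-7's proposed stub 3 `CornerSignRecord13` is FALSE MODULO «an admissible proviso-carrying tuple whose β of record
  vanishes on a box» (the card's self-declared strictness, by name); `cornerAnchor_zero_of_zeroOnBox`.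

HONEST FRAMING: hypothesis SHAPES and kernel junctions; nothing of Bałaban's asserted; neither H is constructed; K2⁷ OPEN; the Clay YM mass gap is NOT proved by
any of this (R4 = conditional finite-𝕋⁴ rung `BalabanLadder.UV` only).
-/

noncomputable section

open scoped Matrix.Norms.L2Operator

namespace Summit.QuantumFields.YangMills.Cruxes.EndpointGivenBR13SepCoPH.Crit2Round2

open Filter Topology
open Literature.MathematicalPhysics.QuantumFieldTheory.Balaban1983to89
open Literature.MathematicalPhysics.QuantumFieldTheory.Balaban1983to89.FlowStep
open Literature.MathematicalPhysics.QuantumFieldTheory.Balaban1983to89.T4Continuum (T4Family)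
open Literature.MathematicalPhysics.QuantumFieldTheory.Balaban1983to89.B12Beta (HistBox)
open Literature.MathematicalPhysics.QuantumFieldTheory.Balaban1983to89.Beta.Drift (OneLoopDrift)
open Summit.QuantumFields.YangMills.Theorems.BalabanUVNodesK2JsOfRecord (StepColourData beta0OfJs BoxRemainder)
open Summit.QuantumFields.YangMills.Theorems.BalabanUVNodesK2Line1PrimeRemainderPrice
open Summit.QuantumFields.YangMills.Theorems.EndpointGivenBR13SepCoPH.Negative.RemNamedJets13FalseOfTwoNormalisations
  (remNamedJetsC_pair_false_of_twoNormalisations)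

/-! ## §A IDEA-5 edition 2 — record-level texts VERBATIM from `ConvexFibreWittenSketch2.lean` :47–:78 and the sketch's proof :80–:117 -/

section Idea5

def RemAtCPkg (F : T4Family) (κ : StepColourData) (θ : Node00.Stage13HParams F 2) (hP : θ.Provisos₁₃SepCoPH F 2) : Prop :=
  ∃ γ₀ s β' : ℝ, 0 < γ₀ ∧ γ₀ ≤ θ.γ ∧ 0 ≤ s ∧ s ≤ B12Normalization.stepBal 2 F.L ∧ 0 ≤ β' ∧
    (∀ (k : ℕ) (p : Fin (k + 1) → ℝ), p ∈ HistBox γ₀ k → |(Node00.datumOfRecord₁₃SepCoPH F 2 θ hP).βfun k p - beta0OfJs F κ k| ≤ s) ∧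
    (∀ (k : ℕ) (δ : ℝ), 0 < δ → ∃ γ : ℝ, 0 < γ ∧ ∀ p : Fin (k + 1) → ℝ, p ∈ HistBox γ k →
      |(Node00.datumOfRecord₁₃SepCoPH F 2 θ hP).βfun k p - beta0OfJs F κ k| ≤ δ) ∧
    BetaContH γ₀ (Node00.datumOfRecord₁₃SepCoPH F 2 θ hP).βfun ∧
    BetaUpperH β' γ₀ (Node00.datumOfRecord₁₃SepCoPH F 2 θ hP).βfun

def ModPkgAt (F : T4Family) (κ : StepColourData) (θ : Node00.Stage13HParams F 2) (hP : θ.Provisos₁₃SepCoPH F 2) : Prop :=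
  ∃ (γ₀ β' : ℝ) (ω : ℝ → ℝ), 0 < γ₀ ∧ γ₀ ≤ θ.γ ∧ 0 ≤ β' ∧ Tendsto ω (𝓝[>] 0) (𝓝 0) ∧
    (∀ (k : ℕ) (p : Fin (k + 1) → ℝ), p ∈ HistBox γ₀ k →
      |(Node00.datumOfRecord₁₃SepCoPH F 2 θ hP).βfun k p - beta0OfJs F κ k| ≤ ω (p (Fin.last k))) ∧
    BetaContH γ₀ (Node00.datumOfRecord₁₃SepCoPH F 2 θ hP).βfun ∧
    BetaUpperH β' γ₀ (Node00.datumOfRecord₁₃SepCoPH F 2 θ hP).βfun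

def ModulusAtSomeJets13 : Prop :=
  ∀ F : T4Family, ∃ κ : StepColourData, ∀ (θ : Node00.Stage13HParams F 2) (hP : θ.Provisos₁₃SepCoPH F 2), θ.Admissible F 2 → ModPkgAt F κ θ hP

def RemAtCSomeJets13 : Prop :=
  ∀ F : T4Family, ∃ κ : StepColourData, ∀ (θ : Node00.Stage13HParams F 2) (hP : θ.Provisos₁₃SepCoPH F 2), θ.Admissible F 2 → RemAtCPkg F κ θ hP

def D1AtShadowingJetsC13 : Prop :=
  ∀ (F : T4Family) (κ : StepColourData) (θ : Node00.Stage13HParams F 2) (hP : θ.Provisos₁₃SepCoPH F 2), θ.Admissible F 2 →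
    RemAtCPkg F κ θ hP → ∃ A : ℝ, OneLoopDrift (B12Normalization.stepBal 2 F.L) A (beta0OfJs F κ)

theorem stepBal_two_pos (F : T4Family) : 0 < B12Normalization.stepBal 2 (F.L : ℝ) :=
  B12Normalization.stepBal_pos (by norm_num) (by exact_mod_cast F.hL.2)

theorem exists_Ioo_of_tendsto {ω : ℝ → ℝ} (hω : Tendsto ω (𝓝[>] 0) (𝓝 0)) {ε : ℝ} (hε : 0 < ε) :
    ∃ u : ℝ, 0 < u ∧ ∀ t : ℝ, 0 < t → t < u → ω t < ε := by
  have hmem : ω ⁻¹' Set.Iio ε ∈ 𝓝[>] (0 : ℝ) := hω (Iio_mem_nhds hε)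
  obtain ⟨u, hu, hsub⟩ := mem_nhdsGT_iff_exists_Ioo_subset.mp hmem
  exact ⟨u, hu, fun t ht htu => hsub ⟨ht, htu⟩⟩

/-- (the sketch's `remAtCPkg_of_modPkgAt`, proof copied) -/
theorem remAtCPkg_of_modPkgAt (F : T4Family) (κ : StepColourData) (θ : Node00.Stage13HParams F 2) (hP : θ.Provisos₁₃SepCoPH F 2)
    (h : ModPkgAt F κ θ hP) : RemAtCPkg F κ θ hP := by
  obtain ⟨γ₀, β', ω, hγ₀, hle, hβ', hω, hmod, hcont, hup⟩ := h
  have hs := stepBal_two_pos F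
  obtain ⟨u, hu, hωu⟩ := exists_Ioo_of_tendsto hω hs
  set γ₁ : ℝ := min γ₀ (u / 2) with hγ₁
  have hγ₁pos : 0 < γ₁ := lt_min hγ₀ (by linarith)
  have hγ₁le : γ₁ ≤ γ₀ := min_le_left _ _
  have hsub : ∀ k (p : Fin (k + 1) → ℝ), p ∈ HistBox γ₁ k → p ∈ HistBox γ₀ k :=
    fun k p hp i => ⟨(hp i).1, (hp i).2.trans hγ₁le⟩
  refine ⟨γ₁, B12Normalization.stepBal 2 F.L, β', hγ₁pos, hγ₁le.trans hle, hs.le, le_rfl, hβ', ?_, ?_, ?_, ?_⟩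
  · intro k p hp
    have hlast : 0 < p (Fin.last k) ∧ p (Fin.last k) ≤ γ₁ := hp (Fin.last k)
    have hlt : p (Fin.last k) < u := lt_of_le_of_lt (hlast.2.trans (min_le_right _ _)) (by linarith)
    exact (hmod k p (hsub k p hp)).trans (hωu _ hlast.1 hlt).le
  · intro k δ hδ
    obtain ⟨u', hu', hωu'⟩ := exists_Ioo_of_tendsto hω hδ
    refine ⟨min γ₀ (u' / 2), lt_min hγ₀ (by linarith), fun p hp => ?_⟩
    have hp₀ : p ∈ HistBox γ₀ k := fun i => ⟨(hp i).1, (hp i).2.trans (min_le_left _ _)⟩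
    have hlast : 0 < p (Fin.last k) ∧ p (Fin.last k) ≤ min γ₀ (u' / 2) := hp (Fin.last k)
    have hlt : p (Fin.last k) < u' := lt_of_le_of_lt (hlast.2.trans (min_le_right _ _)) (by linarith)
    exact (hmod k p hp₀).trans (hωu' _ hlast.1 hlt).le
  · exact fun k => (hcont k).mono (box_mono hγ₁le k)
  · exact fun k v hv => hup k v (box_mono hγ₁le k hv)

theorem remAtCSomeJets13_of_modulusAtSomeJets13 (h : ModulusAtSomeJets13) : RemAtCSomeJets13 := by
  intro F
  obtain ⟨κ, hκ⟩ := h F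
  exact ⟨κ, fun θ hP hθ => remAtCPkg_of_modPkgAt F κ θ hP (hκ θ hP hθ)⟩

/-- **★ IDEA-5 edition 2's line {1″, 2ᴹ} is FALSE MODULO TWO NORMALISATIONS** (CRIT-1 g2's hypothesis, p592392): by `remAtCSomeJets13_of_modulusAtSomeJets13` and
`remNamedJetsC_pair_false_of_twoNormalisations` BY NAME.  The exposure is the inherited `∀ F ∃ κ ∀ θ` with the θ-independent reference `beta0OfJs F κ`. -/
theorem modulusPair13_false_of_twoNormalisations
    (H : ∃ (F : T4Family) (θ θ' : Node00.Stage13HParams F 2) (hP : θ.Provisos₁₃SepCoPH F 2) (hP' : θ'.Provisos₁₃SepCoPH F 2),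
      θ.Admissible F 2 ∧ θ'.Admissible F 2 ∧ ∃ lam γ₁ : ℝ, lam ≠ 1 ∧ 0 < γ₁ ∧
        ∀ (k : ℕ) (p : Fin (k + 1) → ℝ), p ∈ HistBox γ₁ k →
          (Node00.datumOfRecord₁₃SepCoPH F 2 θ' hP').βfun k p = lam * (Node00.datumOfRecord₁₃SepCoPH F 2 θ hP).βfun k p) :
    ¬ (ModulusAtSomeJets13 ∧ D1AtShadowingJetsC13) := by
  rintro ⟨h₂, h₁⟩
  exact remNamedJetsC_pair_false_of_twoNormalisations H ⟨remAtCSomeJets13_of_modulusAtSomeJets13 h₂, h₁⟩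

end Idea5

/-! ## §B IDEA-7 round 2 — `CornerAnchor` ∕ `CornerSignRecord13` VERBATIM from `CornerLimitSignSketch.lean` :57 ∕ :356; the strictness price by name -/

section Idea7

def CornerAnchor (b : ℕ → ℝ) (γ : ℝ) (β : HBeta) : Prop :=
  ∀ k : ℕ, ∀ ε : ℝ, 0 < ε → ∃ δ : ℝ, 0 < δ ∧ δ ≤ γ ∧ ∀ v ∈ Box δ k, |β k v - b k| ≤ ε

def CornerSignRecord13 : Prop :=
  ∀ (F : T4Family) (θ : Node00.Stage13HParams F 2) (hP : θ.Provisos₁₃SepCoPH F 2), θ.Admissible F 2 →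
    ∀ b : ℕ → ℝ, CornerAnchor b θ.γ (Node00.datumOfRecord₁₃SepCoPH F 2 θ hP).βfun →
      ∀ binf : ℝ, Tendsto b atTop (𝓝 binf) → 0 < binf

/-- a β vanishing on the box `]0,γ₁]` (`0 < γ₁`) is corner-anchored to `0` on any window `γ > 0`. [folklore] -/
theorem cornerAnchor_zero_of_zeroOnBox {β : HBeta} {γ γ₁ : ℝ} (hγ : 0 < γ) (hγ₁ : 0 < γ₁)
    (h0 : ∀ (k : ℕ) (v : Fin (k + 1) → ℝ), v ∈ Box γ₁ k → β k v = 0) : CornerAnchor (fun _ => 0) γ β := by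
  intro k ε hε
  refine ⟨min γ γ₁, lt_min hγ hγ₁, min_le_left _ _, fun v hv => ?_⟩
  rw [h0 k v (box_mono (min_le_right γ γ₁) k hv), sub_zero, abs_zero]
  exact hε.le

/-- **★ STRICTNESS OF idea-7's STUB 3, BY NAME**: `CornerSignRecord13` is FALSE MODULO «some admissible proviso-carrying Stage-13 tuple whose β of record VANISHES on a
box» (there the corner limits are `0`, `b ≡ 0 → 0`, and the stub demands `0 < 0`), although THE END may hold at such a tuple (constant flows).  The card declares this
strictness itself («β ≡ 0 fails stub 3 while END holds»); the hypothesis is NOT constructed (instance 0∕1 on the record's β). -/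
theorem cornerSign13_false_of_zeroOnBox
    (H0 : ∃ (F : T4Family) (θ : Node00.Stage13HParams F 2) (hP : θ.Provisos₁₃SepCoPH F 2), θ.Admissible F 2 ∧ ∃ γ₁ : ℝ, 0 < γ₁ ∧
      ∀ (k : ℕ) (v : Fin (k + 1) → ℝ), v ∈ Box γ₁ k → (Node00.datumOfRecord₁₃SepCoPH F 2 θ hP).βfun k v = 0) :
    ¬ CornerSignRecord13 := by
  intro hs
  obtain ⟨F, θ, hP, hθ, γ₁, hγ₁, h0⟩ := H0
  have hγ : 0 < θ.γ := hθ.toStage12.toStage9.gamma_pos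
  have h := hs F θ hP hθ (fun _ => 0) (cornerAnchor_zero_of_zeroOnBox hγ hγ₁ h0) 0 tendsto_const_nhds
  exact lt_irrefl 0 h

/-- … and modulo CRIT-1's two normalisations with the DEGENERATE factor `lam = 0` (a tuple whose β of record is `0 ·` another's on a box) — the `lam ≠ 1`
hypothesis of p592392 does not exclude it. [folklore] -/
theorem cornerSign13_false_of_zeroNormalisation
    (H : ∃ (F : T4Family) (θ θ' : Node00.Stage13HParams F 2) (hP : θ.Provisos₁₃SepCoPH F 2) (hP' : θ'.Provisos₁₃SepCoPH F 2),
      θ.Admissible F 2 ∧ θ'.Admissible F 2 ∧ ∃ γ₁ : ℝ, 0 < γ₁ ∧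
        ∀ (k : ℕ) (p : Fin (k + 1) → ℝ), p ∈ HistBox γ₁ k →
          (Node00.datumOfRecord₁₃SepCoPH F 2 θ' hP').βfun k p = 0 * (Node00.datumOfRecord₁₃SepCoPH F 2 θ hP).βfun k p) :
    ¬ CornerSignRecord13 := by
  obtain ⟨F, θ, θ', hP, hP', -, hθ', γ₁, hγ₁, hprop⟩ := H
  refine cornerSign13_false_of_zeroOnBox ⟨F, θ', hP', hθ', γ₁, hγ₁, fun k v hv => ?_⟩
  have := hprop k v (by rwa [histBox_eq_box])
  rwa [zero_mul] at this

end Idea7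

end Summit.QuantumFields.YangMills.Cruxes.EndpointGivenBR13SepCoPH.Crit2Round2

end
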